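/-
HONEST FRAMING: certified error envelopes and provably optimal rounding/accumulation schemes for
low-precision formats under stated cost models; every table by two implementations; no hardware
or vendor claims.
-/
import Summits.Ventures.CertifiedArithmetic.LowPrec.OptDemotionRoutingQuadNode

/-!
# The demotion law (Theorem T8), part 10l-a: the right-hand options of the popcount-3 e-side rows E3

For `E3(j,k,l): x_(j-1,k-1,l-1) ≤ (1-u) x_(j,k,l) + (1+u) t x_(k-j,l-j,q-j)` (`2 ≤ j < k < l ≤ q-1`;
`t = 2^-j`, `m = 2^-k`, `m_l = 2^-l`, `u = 2^-q`; `c = q-k`, `d = q-j`, `dl = q-l`, `s = l-k`,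
`kj = k-j`, `lj = l-j`) the certificate of part 10l uses, at a node `A·B`, the eight injected
options of `x_(j,k,l)` and the eight of `x_(kj,lj,d)` (part 10l-0 `treeBR_quad_node_ge`), written
here in the cell's offset names and with the scalings the branch lemmas of part 10j-a expect
(`e3_optJKL`, `e3_optR`).
-/

namespace Summit.Ventures.CertifiedArithmetic.LowPrec.Opt

open Literature.ComputerArithmetic.JeannerodRump2018
open Literature.ComputerArithmetic.JeannerodRump2018.SumTree

section E3Opt

variable {q : ℕ}

/-- The eight options of `x_(j,k,l)` at a node, in the offsets `c = q-k`, `d = q-j`, `dl = q-l`,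
`s = l-k`, `kj = k-j`, `lj = l-j`. -/
theorem e3_optJKL (hq : 1 ≤ q) {j k l c d dl s kj lj : ℕ} (hj : 1 ≤ j) (hjk : j < k) (hkl : k < l)
    (hlq : l + 1 ≤ q) (hc : (c : ℤ) = (q : ℤ) - k) (hd : (d : ℤ) = (q : ℤ) - j) (hdl : (dl : ℤ) = (q : ℤ) - l)
    (hs : (s : ℤ) = (l : ℤ) - k) (hkj : (kj : ℤ) = (k : ℤ) - j) (hlj : (lj : ℤ) = (l : ℤ) - j)
    (A B : SumTree) :
    let N := treeBR q (.node A B) {0, -(j : ℤ), -(k : ℤ), -(l : ℤ)}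
    1 + (treeBR q A {0, -(j : ℤ), -(k : ℤ), -(l : ℤ)} + (2 : ℚ) ^ (-(q : ℤ)) * treeBR q B {0}) ≤ N ∧
    1 + (treeBR q A {0, -(j : ℤ), -(k : ℤ)} + (2 : ℚ) ^ (-(l : ℤ)) * treeBR q B {0, -(dl : ℤ)}) ≤ N ∧
    1 + (treeBR q A {0, -(j : ℤ), -(l : ℤ)} + (2 : ℚ) ^ (-(k : ℤ)) * treeBR q B {0, -(c : ℤ)}) ≤ N ∧
    1 + (treeBR q A {0, -(k : ℤ), -(l : ℤ)} + (2 : ℚ) ^ (-(j : ℤ)) * treeBR q B {0, -(d : ℤ)}) ≤ N ∧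
    1 + (treeBR q A {0, -(j : ℤ)} + (2 : ℚ) ^ (-(k : ℤ)) * treeBR q B {0, -(s : ℤ), -(c : ℤ)}) ≤ N ∧
    1 + (treeBR q A {0, -(k : ℤ)} + (2 : ℚ) ^ (-(j : ℤ)) * treeBR q B {0, -(lj : ℤ), -(d : ℤ)}) ≤ N ∧
    1 + (treeBR q A {0, -(l : ℤ)} + (2 : ℚ) ^ (-(j : ℤ)) * treeBR q B {0, -(kj : ℤ), -(d : ℤ)}) ≤ N ∧
    1 + (treeBR q A {0} + (2 : ℚ) ^ (-(j : ℤ)) * treeBR q B {0, -(kj : ℤ), -(lj : ℤ), -(d : ℤ)}) ≤ N := by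
  intro N
  have h := treeBR_quad_node_ge (q := q) hq A B (a := j) (b := k) (e := l) hj hjk hkl hlq
  have e1 : (q : ℤ) - l = dl := by omega
  have e2 : (q : ℤ) - k = c := by omega
  have e3 : (q : ℤ) - j = d := by omega
  have e4 : (l : ℤ) - k = s := by omega
  have e5 : (l : ℤ) - j = lj := by omega
  have e6 : (k : ℤ) - j = kj := by omega
  rw [e1, e2, e3, e4, e5, e6] at h
  exact h

/-- The eight options of `x_(kj,lj,d)` at a node (`kj = k-j`, `lj = l-j`, `d = q-j`), the last
seven scaled by `t = 2^-j` (`t·2^-d = u`, `t·2^-lj = m_l`, `t·2^-kj = m`). -/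
theorem e3_optR (hq : 1 ≤ q) {j k l c d dl s kj lj : ℕ} (hj : 1 ≤ j) (hjk : j < k) (hkl : k < l)
    (hlq : l + 1 ≤ q) (hc : (c : ℤ) = (q : ℤ) - k) (hd : (d : ℤ) = (q : ℤ) - j) (hdl : (dl : ℤ) = (q : ℤ) - l)
    (hs : (s : ℤ) = (l : ℤ) - k) (hkj : (kj : ℤ) = (k : ℤ) - j) (hlj : (lj : ℤ) = (l : ℤ) - j)
    (A B : SumTree) :
    let N := treeBR q (.node A B) {0, -(kj : ℤ), -(lj : ℤ), -(d : ℤ)}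
    let t : ℚ := (2 : ℚ) ^ (-(j : ℤ))
    1 + (treeBR q A {0, -(kj : ℤ), -(lj : ℤ), -(d : ℤ)} + (2 : ℚ) ^ (-(q : ℤ)) * treeBR q B {0}) ≤ N ∧
    t + (t * treeBR q A {0, -(kj : ℤ), -(lj : ℤ)} + (2 : ℚ) ^ (-(q : ℤ)) * treeBR q B {0, -(j : ℤ)}) ≤ t * N ∧
    t + (t * treeBR q A {0, -(kj : ℤ), -(d : ℤ)} + (2 : ℚ) ^ (-(l : ℤ)) * treeBR q B {0, -((dl : ℤ) + j)}) ≤ t * N ∧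
    t + (t * treeBR q A {0, -(lj : ℤ), -(d : ℤ)} + (2 : ℚ) ^ (-(k : ℤ)) * treeBR q B {0, -((c : ℤ) + j)}) ≤ t * N ∧
    t + (t * treeBR q A {0, -(kj : ℤ)} + (2 : ℚ) ^ (-(l : ℤ)) * treeBR q B {0, -(dl : ℤ), -((dl : ℤ) + j)}) ≤ t * N ∧
    t + (t * treeBR q A {0, -(lj : ℤ)} + (2 : ℚ) ^ (-(k : ℤ)) * treeBR q B {0, -(c : ℤ), -((c : ℤ) + j)}) ≤ t * N ∧
    t + (t * treeBR q A {0, -(d : ℤ)} + (2 : ℚ) ^ (-(k : ℤ)) * treeBR q B {0, -(s : ℤ), -((c : ℤ) + j)}) ≤ t * N ∧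
    t + (t * treeBR q A {0} + (2 : ℚ) ^ (-(k : ℤ)) * treeBR q B {0, -(s : ℤ), -(c : ℤ), -((c : ℤ) + j)}) ≤ t * N := by
  intro N t
  obtain ⟨h1, h2, h3, h4, h5, h6, h7, h8⟩ :=
    treeBR_quad_node_ge (q := q) hq A B (a := kj) (b := lj) (e := d) (by omega) (by omega) (by omega) (by omega)
  have e1 : (q : ℤ) - d = j := by omega
  have e2 : (q : ℤ) - lj = (dl : ℤ) + j := by omega
  have e3 : (q : ℤ) - kj = (c : ℤ) + j := by omega
  have e4 : (d : ℤ) - lj = dl := by omega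
  have e5 : (d : ℤ) - kj = c := by omega
  have e6 : (lj : ℤ) - kj = s := by omega
  have pw : ∀ a b : ℤ, (2 : ℚ) ^ a * (2 : ℚ) ^ b = (2 : ℚ) ^ (a + b) := fun a b =>
    (zpow_add₀ (by norm_num) a b).symm
  have ht0 : (0 : ℚ) ≤ t := (zpow_pos (by norm_num : (0 : ℚ) < 2) _).le
  have pd : t * (2 : ℚ) ^ (-(d : ℤ)) = (2 : ℚ) ^ (-(q : ℤ)) := by show (2 : ℚ) ^ (-(j : ℤ)) * _ = _; rw [pw]; congr 1; omega
  have plj : t * (2 : ℚ) ^ (-(lj : ℤ)) = (2 : ℚ) ^ (-(l : ℤ)) := by show (2 : ℚ) ^ (-(j : ℤ)) * _ = _; rw [pw]; congr 1; omega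
  have pkj : t * (2 : ℚ) ^ (-(kj : ℤ)) = (2 : ℚ) ^ (-(k : ℤ)) := by show (2 : ℚ) ^ (-(j : ℤ)) * _ = _; rw [pw]; congr 1; omega
  rw [e1] at h2; rw [e2] at h3; rw [e3] at h4; rw [e4, e2] at h5; rw [e5, e3] at h6; rw [e6, e3] at h7
  rw [e6, e5, e3] at h8
  have sc : ∀ {X Y : ℚ} {w : ℚ}, 1 + (X + w * Y) ≤ N → t + (t * X + (t * w) * Y) ≤ t * N := by
    intro X Y w h
    have h' := mul_le_mul_of_nonneg_left h ht0
    have e : t * (1 + (X + w * Y)) = t + (t * X + (t * w) * Y) := by ring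
    rw [e] at h'; exact h'
  refine ⟨h1, ?_, ?_, ?_, ?_, ?_, ?_, ?_⟩
  · have := sc h2; rw [pd] at this; exact this
  · have := sc h3; rw [plj] at this; exact this
  · have := sc h4; rw [pkj] at this; exact this
  · have := sc h5; rw [plj] at this; exact this
  · have := sc h6; rw [pkj] at this; exact this
  · have := sc h7; rw [pkj] at this; exact this
  · have := sc h8; rw [pkj] at this; exact this

end E3Opt

end Summit.Ventures.CertifiedArithmetic.LowPrec.Opt
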